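import Summits.Ventures.GridStability.Lyapunov.StructurePreservingPhase
import HarnessLib

/-!
# GridStability/Lyapunov/StructurePreservingSublevel — compactness of the sublevel piece and
# uniqueness of the synchronous equilibrium on a momentum level set (structure-preserving model)

Cell `gridfusion` (LADDER-GRIDFUSION), `plan/PARTITION.md` §0 row `Lyapunov/`, A5″; seat
gridfusion-lyap-1 (g2). Sibling of `Lyapunov/StructurePreservingPhase.lean` (phase field, energy,
dissipation identity, constraint set, window, threshold `levelBound`), supplying the two remaining
hypotheses of the tree's Barbashin–Krasovskii theorem
(`Literature.Analysis.ODE.sublevel_subset_regionOfAttraction_of_noCompleteTrajectory`) for MODEL MV-3: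

* `isCompact_sublevel` — for `c < c⋆(θ, β) = g(θ)·β·(π/2 − θ)²/4` the piece
  `S = {x ∈ window ∩ constraintSet | V x ≤ c}` is COMPACT: closed because `V ≤ c` keeps every coupled
  branch STRICTLY inside the window (model-2's `branch_abs_lt_of_energy_le`, so the open window may be
  replaced by the closed one), bounded by model-2's `state_bound_of_energy_le` (generator frequencies,
  D-weighted mean pinned by the momentum, telescoping over the preconnected coupling graph)
  [cite: Padiyar2013, §3.2 eqs (3.11)–(3.15)];
* `eq_of_isSyncEquilibrium_of_momentum_eq` — **uniqueness of the synchronous equilibrium on its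
  momentum level set inside the window**: monotonicity of `sin` on `[−π/2, π/2]`, model-2's
  `half_sum_sub_mul_antisymm`, telescoping (`eq_of_reachable`), `momentum_shift` and `Σ Dᵢ > 0`. It is
  the model-specific content of hypothesis (iii) «no complete positive semi-trajectory in `{V̇ = 0}`
  other than the equilibrium» [cite: RoucheHabetsLaloy1977, Ch. II Thm 1.3].
The assembly is `Lyapunov/StructurePreservingRoa.lean`. THREE COLUMNS: mathematics about the typed
model MV-3; no certificate; no sentence about any grid.
-/

noncomputable section

open Set Filter Topology Real
open Summit.Ventures.GridStability.Models.StructurePreserving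
open Summit.Ventures.GridStability.Models.StructurePreserving.Params

namespace Summit.Ventures.GridStability.Lyapunov.StructurePreserving

variable {n : ℕ}

/-! ### Compactness of the sublevel piece -/

/-- **Compactness of the sublevel piece.** For well-formed data with susceptive couplings
`bᵢⱼ ≥ 0` bounded below by `β > 0` on the edges of a PRECONNECTED coupling graph, `n ≠ 0`, a
reference angle vector with `|δ₀ᵢ − δ₀ⱼ| ≤ θ < π/2` on coupled pairs, and a level `c < c⋆(θ, β)`,
the piece `S = {x ∈ window ∩ constraintSet | V x ≤ c}` is compact: it is CLOSED because on it every
branch is strictly inside the window (model-2's `branch_abs_lt_of_energy_le`, so the open window may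
be replaced by the closed one), and BOUNDED by model-2's `state_bound_of_energy_le` (generator
frequencies, D-weighted mean pinned by the momentum, telescoping over the coupling graph).
[folklore] -/
theorem isCompact_sublevel {p : Params n} (hp : p.WellFormed) (hn : n ≠ 0)
    (hconn : p.couplingGraph.Preconnected) (hb : ∀ i j, 0 ≤ p.b i j) {β : ℝ} (hβ : 0 < β)
    (hβb : ∀ i j, p.couplingGraph.Adj i j → β ≤ p.b i j)
    {δ₀ : Fin n → ℝ} {θ : ℝ} (hθ0 : 0 ≤ θ) (hθ : θ < π / 2)
    (h0 : ∀ i j, p.b i j ≠ 0 → |δ₀ i - δ₀ j| ≤ θ) {c : ℝ} (hc : c < levelBound θ β) :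
    IsCompact {x | x ∈ window p ∩ constraintSet p δ₀ ∧ phaseEnergy p δ₀ x ≤ c} := by
  -- the same set with the CLOSED window
  set S' : Set ((Fin n → ℝ) × (Fin n → ℝ)) :=
    {x | (∀ i j, p.b i j ≠ 0 → |x.1 i - x.1 j| ≤ π / 2) ∧ x ∈ constraintSet p δ₀
      ∧ phaseEnergy p δ₀ x ≤ c} with hS'
  have hSS' : {x | x ∈ window p ∩ constraintSet p δ₀ ∧ phaseEnergy p δ₀ x ≤ c} = S' := by
    ext x
    simp only [hS', mem_setOf_eq, mem_inter_iff, window]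
    constructor
    · rintro ⟨⟨hw, hM⟩, hV⟩
      exact ⟨fun i j hij => (hw i j hij).le, hM, hV⟩
    · rintro ⟨hw, hM, hV⟩
      refine ⟨⟨fun i j hij => ?_, hM⟩, hV⟩
      exact branch_abs_lt_of_energy_le hp hb hβ hβb hθ0 hθ h0 hw
        (by simpa only [phaseEnergy_apply] using hV) (by simpa only [levelBound] using hc) i j hij
  rw [hSS']
  refine Metric.isCompact_of_isClosed_isBounded ?_ ?_
  · -- closed
    have h1 : IsClosed {x : (Fin n → ℝ) × (Fin n → ℝ) |
        ∀ i j, p.b i j ≠ 0 → |x.1 i - x.1 j| ≤ π / 2} := by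
      simp only [setOf_forall]
      refine isClosed_iInter fun i => isClosed_iInter fun j => isClosed_iInter fun _ => ?_
      exact isClosed_le (by fun_prop) continuous_const
    have h3 : IsClosed {x : (Fin n → ℝ) × (Fin n → ℝ) | phaseEnergy p δ₀ x ≤ c} :=
      isClosed_le (contDiff_phaseEnergy p δ₀).continuous continuous_const
    have h := h1.inter ((isClosed_constraintSet p δ₀).inter h3)
    simpa only [hS', setOf_and, setOf_mem_eq] using h
  · -- bounded
    rw [isBounded_iff_forall_norm_le]
    set R : ℝ := (∑ j ∈ p.gen, p.M j * Real.sqrt (2 * c / p.M j)) / (∑ j, p.D j)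
      + n * Real.sqrt (4 * c / ((1 - Real.sin θ) / (π / 2 - θ) * β)) with hR
    set B : ℝ := ∑ j ∈ p.gen, Real.sqrt (2 * c / p.M j) with hB
    refine ⟨R + ‖δ₀‖ + B, fun x hx => ?_⟩
    obtain ⟨hw, ⟨hL, hω0⟩, hV⟩ := hx
    have hst := state_bound_of_energy_le hp hn hconn hb hβ hβb hθ0 hθ h0 hw
      (by simpa only [phaseEnergy_apply] using hV) hL
    have hBnn : 0 ≤ B := Finset.sum_nonneg fun j _ => Real.sqrt_nonneg _
    have hδ : ∀ i, |x.1 i| ≤ R + ‖δ₀‖ := fun i => by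
      have h1 : |x.1 i - δ₀ i| ≤ R := by simpa only [hR] using hst.2 i
      have h2 : |δ₀ i| ≤ ‖δ₀‖ := by
        have := norm_le_pi_norm δ₀ i
        simpa only [Real.norm_eq_abs] using this
      calc |x.1 i| = |(x.1 i - δ₀ i) + δ₀ i| := by ring_nf
        _ ≤ |x.1 i - δ₀ i| + |δ₀ i| := abs_add_le _ _
        _ ≤ R + ‖δ₀‖ := add_le_add h1 h2
    have hRnn : 0 ≤ R + ‖δ₀‖ := by
      obtain ⟨k, hk⟩ := Nat.exists_eq_succ_of_ne_zero hn
      subst hk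
      exact (abs_nonneg _).trans (hδ 0)
    have hω : ∀ i, |x.2 i| ≤ B := fun i => by
      by_cases hi : i ∈ p.gen
      · exact (hst.1 i hi).trans (Finset.single_le_sum (f := fun j => Real.sqrt (2 * c / p.M j))
          (fun j _ => Real.sqrt_nonneg _) hi)
      · rw [hω0 i hi, abs_zero]
        exact hBnn
    have hn1 : ‖x.1‖ ≤ R + ‖δ₀‖ + B := by
      refine (pi_norm_le_iff_of_nonneg (add_nonneg hRnn hBnn)).2 fun i => ?_
      rw [Real.norm_eq_abs]
      exact (hδ i).trans (le_add_of_nonneg_right hBnn)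
    have hn2 : ‖x.2‖ ≤ R + ‖δ₀‖ + B := by
      refine (pi_norm_le_iff_of_nonneg (add_nonneg hRnn hBnn)).2 fun i => ?_
      rw [Real.norm_eq_abs]
      exact (hω i).trans (le_add_of_nonneg_left hRnn)
    rw [Prod.norm_def]
    exact max_le hn1 hn2

/-! ### Uniqueness of the synchronous equilibrium on a momentum level set -/

/-- **The synchronous equilibrium is unique on its momentum level set inside the window.** For
well-formed data with susceptive couplings, a preconnected coupling graph and `n ≠ 0`: if `δ₀`
(`|δ₀ᵢ − δ₀ⱼ| ≤ θ < π/2` on coupled pairs) and `δ` (`|δᵢ − δⱼ| ≤ π/2` on coupled pairs) are both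
synchronous equilibria (`fᵢ(δ) = P̄ᵢ = fᵢ(δ₀)`) and `L(δ, 0) = L(δ₀, 0)`, then `δ = δ₀`. Proof:
`0 = Σᵢ (δᵢ − δ₀ᵢ)(fᵢ(δ) − fᵢ(δ₀)) = ½ Σᵢⱼ bᵢⱼ (Δσᵢⱼ)(sin σᵢⱼ − sin σ₀ᵢⱼ)` (model-2's
`half_sum_sub_mul_antisymm`), every term is `≥ 0` by monotonicity of `sin` on `[−π/2, π/2]` and
vanishes only for `σᵢⱼ = σ₀ᵢⱼ`; so `δ − δ₀` is constant on edges, hence everywhere (preconnected),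
and the momentum pins the constant to `0` (`momentum_shift`, `Σ Dᵢ > 0`). This is hypothesis (iii)
of Barbashin–Krasovskii for MODEL MV-3 («no complete trajectory in `{V̇ = 0}` other than the
equilibrium»: such a trajectory is a rest point, `StructurePreservingRoa`). [folklore] -/
theorem eq_of_isSyncEquilibrium_of_momentum_eq {p : Params n} (hp : p.WellFormed) (hn : n ≠ 0)
    (hconn : p.couplingGraph.Preconnected) (hb : ∀ i j, 0 ≤ p.b i j)
    {δ₀ δ : Fin n → ℝ} {θ : ℝ} (hθ : θ < π / 2)
    (h0 : ∀ i j, p.b i j ≠ 0 → |δ₀ i - δ₀ j| ≤ θ)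
    (hP : ∀ i j, p.b i j ≠ 0 → |δ i - δ j| ≤ π / 2)
    (hδ₀ : p.IsSyncEquilibrium δ₀) (hδ : p.IsSyncEquilibrium δ)
    (hL : p.momentum δ 0 = p.momentum δ₀ 0) : δ = δ₀ := by
  set φ : Fin n → ℝ := fun i => δ i - δ₀ i with hφ
  set A : Fin n → Fin n → ℝ := fun i j => Real.sin (δ i - δ j) - Real.sin (δ₀ i - δ₀ j) with hA
  have hanti : ∀ i j, A j i = -A i j := fun i j => by
    simp only [hA]
    rw [← neg_sub (δ i) (δ j), ← neg_sub (δ₀ i) (δ₀ j), Real.sin_neg, Real.sin_neg]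
    ring
  -- Σᵢ φᵢ Σⱼ bᵢⱼ Aᵢⱼ = Σᵢ φᵢ (fᵢ(δ) − fᵢ(δ₀)) = 0
  have hrow : ∀ i, ∑ j, p.b i j * A i j = p.pe δ i - p.pe δ₀ i := fun i => by
    simp only [hA, Params.pe, ← Finset.sum_sub_distrib]
    exact Finset.sum_congr rfl fun j _ => by ring
  have hzero : ∑ i, φ i * ∑ j, p.b i j * A i j = 0 :=
    Finset.sum_eq_zero fun i _ => by rw [hrow i, hδ i, hδ₀ i, sub_self, mul_zero]
  have hhalf := half_sum_sub_mul_antisymm p.b A φ hp.b_symm hanti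
  rw [hzero] at hhalf
  -- every term is nonnegative
  have hφA : ∀ i j, (φ i - φ j) * A i j = ((δ i - δ j) - (δ₀ i - δ₀ j))
      * (Real.sin (δ i - δ j) - Real.sin (δ₀ i - δ₀ j)) := fun i j => by
    simp only [hφ, hA]
    ring
  have hmono : ∀ {s s₀ : ℝ}, |s| ≤ π / 2 → |s₀| ≤ π / 2 →
      0 ≤ (s - s₀) * (Real.sin s - Real.sin s₀) := by
    intro s s₀ hs hs₀
    have hs' := abs_le.1 hs
    have hs₀' := abs_le.1 hs₀
    rcases lt_trichotomy s s₀ with hlt | heq | hgt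
    · have := Real.sin_lt_sin_of_lt_of_le_pi_div_two (by linarith) (by linarith) hlt
      nlinarith
    · rw [heq]; simp
    · have := Real.sin_lt_sin_of_lt_of_le_pi_div_two (by linarith) (by linarith) hgt
      nlinarith
  have hstrict : ∀ {s s₀ : ℝ}, |s| ≤ π / 2 → |s₀| ≤ π / 2 → s ≠ s₀ →
      0 < (s - s₀) * (Real.sin s - Real.sin s₀) := by
    intro s s₀ hs hs₀ hne
    have hs' := abs_le.1 hs
    have hs₀' := abs_le.1 hs₀
    rcases lt_or_gt_of_ne hne with hlt | hgt
    · have := Real.sin_lt_sin_of_lt_of_le_pi_div_two (by linarith) (by linarith) hlt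
      nlinarith
    · have := Real.sin_lt_sin_of_lt_of_le_pi_div_two (by linarith) (by linarith) hgt
      nlinarith
  have hterm : ∀ i j, 0 ≤ p.b i j * ((φ i - φ j) * A i j) := by
    intro i j
    by_cases hij : p.b i j = 0
    · rw [hij, zero_mul]
    · rw [hφA]
      exact mul_nonneg (hb i j) (hmono (hP i j hij) ((h0 i j hij).trans hθ.le))
  -- hence every coupled term vanishes: σᵢⱼ = σ₀ᵢⱼ on edges
  have hsum0 : ∑ i, ∑ j, p.b i j * ((φ i - φ j) * A i j) = 0 := by
    have h2 : (1 / 2 : ℝ) ≠ 0 := by norm_num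
    exact (mul_eq_zero.1 hhalf).resolve_left h2
  have hedge : ∀ i j, p.couplingGraph.Adj i j → φ i = φ j := by
    intro i j hij
    have hbij : p.b i j ≠ 0 := ((p.couplingGraph_adj_of_symm hp.b_symm i j).1 hij).2
    have h1 := (Finset.sum_eq_zero_iff_of_nonneg fun i _ =>
      Finset.sum_nonneg fun j _ => hterm i j).1 hsum0 i (Finset.mem_univ i)
    have h2 := (Finset.sum_eq_zero_iff_of_nonneg fun j _ => hterm i j).1 h1 j (Finset.mem_univ j)
    have h3 : (φ i - φ j) * A i j = 0 := (mul_eq_zero.1 h2).resolve_left hbij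
    by_contra hne
    have hne' : δ i - δ j ≠ δ₀ i - δ₀ j := by
      intro h
      apply hne
      simp only [hφ]
      linarith
    have hpos := hstrict (hP i j hbij) ((h0 i j hbij).trans hθ.le) hne'
    rw [hφA] at h3
    exact absurd h3 hpos.ne'
  -- preconnected: φ is constant; the momentum pins the constant
  obtain ⟨k, hk⟩ := Nat.exists_eq_succ_of_ne_zero hn
  subst hk
  have hconst : ∀ i, φ i = φ 0 := fun i => p.eq_of_reachable hedge (hconn i 0)
  have hshift : δ = fun i => δ₀ i + φ 0 := by
    funext i
    have := hconst i
    simp only [hφ] at this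
    linarith
  have hLs : p.momentum δ 0 = p.momentum δ₀ 0 + φ 0 * ∑ i, p.D i := by
    rw [hshift]
    exact p.momentum_shift δ₀ 0 (φ 0)
  have hc : φ 0 * ∑ i, p.D i = 0 := by linarith
  have hc0 : φ 0 = 0 := (mul_eq_zero.1 hc).resolve_right (sum_D_pos hp (Nat.succ_ne_zero k)).ne'
  rw [hshift, hc0]
  funext i
  simp

end Summit.Ventures.GridStability.Lyapunov.StructurePreserving

end
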